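import Literature.RingTheory.Henselian.FiniteFlatHopfAlgebraTranslations
import Literature.RingTheory.Henselian.FiniteFlatHopfAlgebraUnitFactor
import Literature.RingTheory.Idempotents.FiniteAlgebraLocalFactorsRank
import Mathlib.FieldTheory.IsAlgClosed.Basic
import Mathlib.RingTheory.Henselian
import HarnessLib

/-!
# The rank of a finite flat group scheme is the number of its geometric points times the rank of its unit component
# ([Tate1997FiniteFlatGroupSchemes] (3.7): `[G : S] = #G(k̄) · [G⁰ : S]`), algebra currency

Topic `Literature/RingTheory/Henselian`; namespace `Literature.RingTheory.Henselian` (sibling of ★ `FiniteFlatHopfAlgebraTranslations`,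
★ `FiniteFlatHopfAlgebraUnitFactor`, ★ `Idempotents/FiniteAlgebraLocalFactorsRank`).  THEOREMS ONLY (no definition ∕ instance ∕ notation ∕
named fact ∕ `sorry`).  Cell `pub/hodgecm-mathlib` (D-0151), FLOOR 0, P6 «MOD programme», sub-line P6b `Cruxes/HLiu418/Lines/F0_P6b_ConnectedEtale.lean`
ED. 2, stub `stub_b1cg_rankEqCardMulRank_geom` (σ1 «HOPF-corner over `k`», F0P6b-plan DEAL 2026-09-01); `--supports stmt-HodgeConjecture-24832`.
HC_CM is proved only modulo the printed citations until rung 0 closes; count-neutral generic algebra.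

THE PRINT.  [Tate1997FiniteFlatGroupSchemes] (3.7) (pp. 140–142), `R` henselian local, `G = Spec A` finite flat, `A = ∏ Aᵢ` the local
factors, `G⁰ = Spec A⁰` the unit factor: the translations by points permute the local factors, so over an algebraically closed residue
field (or after base change to `k̄`) every local factor is isomorphic to `A⁰` and «the order of `G` is the order of `G⁰` times the number of
points».  The tree holds the pieces in algebra currency: the local factors and their separating idempotents (★
`Henselian.exists_completeOrthogonalIdempotents_maximalSpectrum`, `isLocalRing_quotient_span_one_sub`), rank additivity and the distribution
of points over the corners (★ `Idempotents.finrank_eq_sum_finrank_quotient`, `card_algHom_eq_sum`, `free_quotient_span_one_sub`), and «the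
corner at the reduction of a rational point is isomorphic to the unit corner» (★ `Henselian.finrank_corner_eq_finrank_unitCorner`).  THIS FILE
assembles the COUNT:

* §1 over an ALGEBRAICALLY CLOSED field `k`, a module-finite LOCAL `k`-algebra has exactly one `k`-point (`nat_card_algHom_eq_one_of_isLocalRing`);
* §2 **`finrank_eq_card_algHom_mul_finrank_unitCorner`** — `k` algebraically closed, `C` a module-finite commutative Hopf `k`-algebra, `e₁` the
  unit separating idempotent (`e₁ ≡ 1 (mod 𝔫_ε)`, `e₁ ∈ 𝔫` for every other maximal `𝔫`): `dim_k C = #(C →ₐ[k] k) · dim_k (C ⧸ (1 − e₁))`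
  (every maximal ideal is the kernel of exactly one `k`-point, and every corner is the unit corner translated);
* §3 BASE CHANGE from a LOCAL ring: `R` local, `B` a module-finite FREE commutative Hopf `R`-algebra with unit separating idempotent `e`, `k` an
  algebraically closed field and `R → k` a ring map killing `𝔪_R`: **`finrank_eq_card_algHom_mul_finrank_unitCorner_of_isLocalRing`** —
  `rank_R B = #(B →ₐ[R] k) · rank_R (B ⧸ (1 − e))`.  Mechanism: `C := k ⊗_R B` is a finite Hopf `k`-algebra (Mathlib), `1 ⊗ e` is ITS unit
  separating idempotent — the one non-formal point, «`(G⁰)_k = (G_k)⁰`»: an `R`-algebra map `B → k` through the unit corner `B ⧸ (1 − e)` is the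
  counit point, because the corner is local with residue field `κ(R)` and its maximal ideal is nilpotent modulo `𝔪_R`
  (`algHom_eq_of_map_unitIdempotent_eq_one`) —, and ranks ∕ points ∕ corners commute with `k ⊗_R −` (Mathlib `Module.finrank_baseChange`,
  `Algebra.TensorProduct.liftEquiv`, `Algebra.TensorProduct.lTensor_ker`).

## References
* [Tate1997FiniteFlatGroupSchemes] J. Tate, *Finite flat group schemes*, in: Modular Forms and Fermat's Last Theorem (1997), (3.7) (pp. 140–142:
  the connected–étale sequence, `G⁰`, «the `Gᵢ` are permuted by translations»).
* [StacksProject] The Stacks Project, Tag 04GG (finite algebras over henselian local rings), Tags 00EC ∕ 00ED (idempotents and products).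
-/

set_option autoImplicit false

noncomputable section

universe u v w

open IsLocalRing TensorProduct

namespace Literature.RingTheory.Henselian

/-! ## §1 A finite local algebra over an algebraically closed field has exactly one rational point -/

section OnePoint

variable (k : Type u) [Field k] [IsAlgClosed k] (L : Type v) [CommRing L] [Algebra k L] [IsLocalRing L] [Module.Finite k L]

omit [IsAlgClosed k] [Module.Finite k L] in
/-- Two `k`-algebra maps from a LOCAL `k`-algebra to the field `k` coincide (both have kernel the maximal ideal, and an element is
congruent to its value modulo the kernel). [cite: StacksProject, Tag 00EC] -/
theorem algHom_ext_of_isLocalRing (f g : L →ₐ[k] k) : f = g := by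
  have hkf : RingHom.ker (f : L →+* k) = maximalIdeal L :=
    IsLocalRing.eq_maximalIdeal (RingHom.ker_isMaximal_of_surjective _ fun x => ⟨algebraMap k L x, by simp⟩)
  have hkg : RingHom.ker (g : L →+* k) = maximalIdeal L :=
    IsLocalRing.eq_maximalIdeal (RingHom.ker_isMaximal_of_surjective _ fun x => ⟨algebraMap k L x, by simp⟩)
  ext x
  have hx : x - algebraMap k L (f x) ∈ RingHom.ker (g : L →+* k) := by
    rw [hkg, ← hkf, RingHom.mem_ker]; simp
  rw [RingHom.mem_ker, AlgHom.coe_toRingHom, map_sub, AlgHom.commutes, Algebra.algebraMap_self, RingHom.id_apply,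
    sub_eq_zero] at hx
  exact hx.symm

/-- **A module-finite LOCAL algebra over an ALGEBRAICALLY CLOSED field `k` has exactly one `k`-point** (its residue field is a finite,
hence trivial, extension of `k`). [cite: StacksProject, Tag 00EC] -/
theorem nat_card_algHom_eq_one_of_isLocalRing : Nat.card (L →ₐ[k] k) = 1 := by
  haveI : Algebra.IsIntegral k (ResidueField L) := Algebra.IsIntegral.of_finite k _
  -- existence: `L → κ(L) ≅ k`
  let e : ResidueField L ≃ₐ[k] k :=
    (AlgEquiv.ofBijective (Algebra.ofId k (ResidueField L))
      (IsAlgClosed.algebraMap_bijective_of_isIntegral (k := k) (K := ResidueField L))).symm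
  let f₀ : L →ₐ[k] k := (e : ResidueField L →ₐ[k] k).comp (IsScalarTower.toAlgHom k L (ResidueField L))
  rw [Nat.card_eq_one_iff_unique]
  exact ⟨⟨fun f g => algHom_ext_of_isLocalRing k L f g⟩, ⟨f₀⟩⟩

/-- … in particular the `k`-points form a finite set. [cite: StacksProject, Tag 00EC] -/
theorem finite_algHom_of_isLocalRing : Finite (L →ₐ[k] k) :=
  Nat.finite_of_card_ne_zero (by rw [nat_card_algHom_eq_one_of_isLocalRing k L]; exact one_ne_zero)

end OnePoint

/-! ## §2 Over an algebraically closed field: `dim_k C = #(C →ₐ[k] k) · dim_k (C ⧸ (1 − e₁))` -/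

section FieldCount

variable (k : Type u) [Field k] [IsAlgClosed k] {C : Type v} [CommRing C] [HopfAlgebra k C] [Module.Finite k C]

/-- **TATE (3.7): `[G : k] = #G(k) · [G⁰ : k]`** for a finite commutative group scheme `G = Spec C` over an ALGEBRAICALLY CLOSED field `k`, in
corner currency: with `e₁` the unit separating idempotent (`e₁ ≡ 1 (mod 𝔫_ε)`, `e₁ ∈ 𝔫` for every other maximal ideal `𝔫`; it exists, ★
`Henselian.exists_unit_idempotent`), `dim_k C = #(C →ₐ[k] k) · dim_k (C ⧸ (1 − e₁))`.  Proof: `C = ∏_𝔫 C ⧸ (1 − e_𝔫)` over the maximal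
ideals (★ separating idempotents), each corner is local hence has exactly one `k`-point (§1), so `#(C →ₐ[k] k) = #MaxSpec C` (★
`Idempotents.card_algHom_eq_sum`), and each corner is isomorphic to the unit corner by the translation through its point (★
`Henselian.finrank_corner_eq_finrank_unitCorner`), so `dim_k C = Σ_𝔫 dim (C ⧸ (1 − e_𝔫)) = #MaxSpec C · dim (C ⧸ (1 − e₁))` (★
`Idempotents.finrank_eq_sum_finrank_quotient`). [cite: Tate1997FiniteFlatGroupSchemes, (3.7) (pp. 140–142)] [cite: StacksProject, Tag 04GG] -/
theorem finrank_eq_card_algHom_mul_finrank_unitCorner {e₁ : C} (he₁ : IsIdempotentElem e₁)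
    (he₁1 : e₁ - 1 ∈ RingHom.ker ((residue k).comp (Bialgebra.counitAlgHom k C : C →+* k)))
    (he₁0 : ∀ 𝔪 : Ideal C, 𝔪.IsMaximal → 𝔪 ≠ RingHom.ker ((residue k).comp (Bialgebra.counitAlgHom k C : C →+* k)) → e₁ ∈ 𝔪) :
    Module.finrank k C = Nat.card (C →ₐ[k] k) * Module.finrank k (C ⧸ Ideal.span {1 - e₁}) := by
  classical
  haveI : Fintype (MaximalSpectrum C) :=
    @Fintype.ofFinite _ (Literature.RingTheory.Idempotents.finite_maximalSpectrum (R := k) (A := C))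
  obtain ⟨e, he, he1, he0⟩ := exists_completeOrthogonalIdempotents_maximalSpectrum k (S := C)
  -- every corner is local
  have hloc : ∀ 𝔫 : MaximalSpectrum C, IsLocalRing (C ⧸ Ideal.span {1 - e 𝔫}) := fun 𝔫 => by
    haveI := 𝔫.isMaximal
    exact (isLocalRing_quotient_span_one_sub (e 𝔫) 𝔫.asIdeal (he1 𝔫)
      fun 𝔫' h𝔫' hne => he0 𝔫 ⟨𝔫', h𝔫'⟩ (fun h' => hne (congrArg MaximalSpectrum.asIdeal h').symm)).1
  haveI : ∀ 𝔫 : MaximalSpectrum C, Finite ((C ⧸ Ideal.span {1 - e 𝔫}) →ₐ[k] k) := fun 𝔫 =>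
    haveI := hloc 𝔫; finite_algHom_of_isLocalRing k _
  -- points: one per corner
  have hΩ : ∀ x : k, IsIdempotentElem x → x = 0 ∨ x = 1 := fun x hx => IsIdempotentElem.iff_eq_zero_or_one.mp hx
  have hcard : Nat.card (C →ₐ[k] k) = Fintype.card (MaximalSpectrum C) := by
    rw [Literature.RingTheory.Idempotents.card_algHom_eq_sum (R := k) (Ω := k) hΩ he]
    rw [Finset.sum_congr rfl fun 𝔫 _ => (by haveI := hloc 𝔫; exact nat_card_algHom_eq_one_of_isLocalRing k _ :
      Nat.card ((C ⧸ Ideal.span {1 - e 𝔫}) →ₐ[k] k) = 1)]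
    simp
  -- ranks: every corner has the rank of the unit corner
  have hrank : ∀ 𝔫 : MaximalSpectrum C,
      Module.finrank k (C ⧸ Ideal.span {1 - e 𝔫}) = Module.finrank k (C ⧸ Ideal.span {1 - e₁}) := fun 𝔫 => by
    haveI := 𝔫.isMaximal
    haveI := hloc 𝔫
    -- the point of `C` through the corner at `𝔫`
    have hpos : 0 < Nat.card ((C ⧸ Ideal.span {1 - e 𝔫}) →ₐ[k] k) := by
      rw [nat_card_algHom_eq_one_of_isLocalRing k]; exact Nat.one_pos
    obtain ⟨g₀⟩ := (Nat.card_pos_iff.mp hpos).1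
    let g : C →ₐ[k] k := g₀.comp (Ideal.Quotient.mkₐ k (Ideal.span {1 - e 𝔫}))
    have hg1 : g (e 𝔫) = 1 := by
      change g₀ (Ideal.Quotient.mk (Ideal.span {1 - e 𝔫}) (e 𝔫)) = 1
      have : Ideal.Quotient.mk (Ideal.span {1 - e 𝔫}) (e 𝔫) = 1 := by
        rw [eq_comm, ← map_one (Ideal.Quotient.mk (Ideal.span {1 - e 𝔫})), Ideal.Quotient.eq]
        exact Ideal.subset_span rfl
      rw [this, map_one]
    -- the kernel of `residue ∘ g` is `𝔫`
    have hres : Function.Injective (residue k) := fun a b hab => by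
      have h0 : residue k (a - b) = 0 := by rw [map_sub, hab, sub_self]
      rw [IsLocalRing.residue_eq_zero_iff, IsLocalRing.mem_maximalIdeal, mem_nonunits_iff, isUnit_iff_ne_zero,
        not_not, sub_eq_zero] at h0
      exact h0
    have hker : RingHom.ker ((residue k).comp (g : C →+* k)) = 𝔫.asIdeal := by
      have hk' : RingHom.ker ((residue k).comp (g : C →+* k)) = RingHom.ker (g : C →+* k) := by
        ext x; simp only [RingHom.mem_ker, RingHom.comp_apply]; rw [← map_zero (residue k)]; exact hres.eq_iff
      rw [hk']
      haveI hmax : (RingHom.ker (g : C →+* k)).IsMaximal :=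
        RingHom.ker_isMaximal_of_surjective _ fun x => ⟨algebraMap k C x, by simp⟩
      by_contra hne
      have hmem : e 𝔫 ∈ RingHom.ker (g : C →+* k) :=
        he0 𝔫 ⟨RingHom.ker (g : C →+* k), hmax⟩ (fun h' => hne (congrArg MaximalSpectrum.asIdeal h').symm)
      rw [RingHom.mem_ker] at hmem
      exact one_ne_zero ((hg1.symm.trans hmem : (1 : k) = 0))
    refine finrank_corner_eq_finrank_unitCorner (R := k) g he₁ he₁1 he₁0 (he.idem 𝔫) ?_ ?_
    · rw [hker]; exact he1 𝔫
    · intro 𝔪 h𝔪 hne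
      rw [hker] at hne
      exact he0 𝔫 ⟨𝔪, h𝔪⟩ (fun h' => hne (congrArg MaximalSpectrum.asIdeal h').symm)
  rw [Literature.RingTheory.Idempotents.finrank_eq_sum_finrank_quotient (R := k) he, Finset.sum_congr rfl fun 𝔫 _ => hrank 𝔫,
    Finset.sum_const, Finset.card_univ, smul_eq_mul, hcard]

end FieldCount


/-! ## §3 Base change from a local ring: `rank_R B = #(B →ₐ[R] k) · rank_R (B ⧸ (1 − e))` for `k` algebraically closed over `κ(R)` -/

section UnitCornerPoints

variable {R : Type u} [CommRing R] [IsLocalRing R] {B : Type v} [CommRing B] [Bialgebra R B] [Module.Finite R B]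
  {k : Type w} [CommRing k] [IsReduced k] [Algebra R k]

/-- **An `R`-algebra map `B → k` through the UNIT CORNER is the counit point** («`(G⁰)_k = (G_k)⁰`», the non-formal step of the base
change): `R` local, `B` a module-finite commutative bialgebra with unit separating idempotent `e` (`e ≡ 1 (mod 𝔫_ε)`, `e ∈ 𝔫` for the other
maximal ideals), `k` a REDUCED `R`-algebra in which `𝔪_R` dies; then every `g : B →ₐ[R] k` with `g(e) = 1` is `b ↦ ε(b)·1`.  Indeed `g`
factors through the local corner `B₀ = B ⧸ (1 − e)` (★ `Henselian.isLocalRing_unitCorner`), whose maximal ideal is nilpotent modulo `𝔪_R B₀`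
(`B₀ ⧸ 𝔪_R B₀` is artinian local) and is therefore killed by `g`, and `x ≡ ε̄(x) (mod 𝔪_{B₀})`.
[cite: Tate1997FiniteFlatGroupSchemes, (3.7) (I) (p. 141: «`G⁰` is the spectrum of a henselian local `R`-algebra with the same residue field as `R`»)] -/
theorem algHom_eq_of_map_unitIdempotent_eq_one (hk : maximalIdeal R ≤ RingHom.ker (algebraMap R k)) {e : B}
    (he : IsIdempotentElem e) (he1 : e - 1 ∈ RingHom.ker ((residue R).comp (Bialgebra.counitAlgHom R B : B →+* R)))
    (he0 : ∀ 𝔫 : Ideal B, 𝔫.IsMaximal → 𝔫 ≠ RingHom.ker ((residue R).comp (Bialgebra.counitAlgHom R B : B →+* R)) → e ∈ 𝔫)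
    (g : B →ₐ[R] k) (hg : g e = 1) (b : B) : g b = algebraMap R k (Coalgebra.counit (R := R) b) := by
  set I : Ideal B := Ideal.span {1 - e} with hI
  obtain ⟨hloc, -⟩ := isLocalRing_unitCorner (R := R) he1 he0
  haveI := hloc
  -- `g` and `ε` descend to the corner `B₀ = B ⧸ (1 - e)`
  have hgI : ∀ a ∈ I, g a = 0 := fun a ha => by
    obtain ⟨c, rfl⟩ := Ideal.mem_span_singleton'.mp ha
    rw [map_mul, map_sub, map_one, hg, sub_self, mul_zero]
  have hεI : ∀ a ∈ I, (Bialgebra.counitAlgHom R B) a = 0 := fun a ha =>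
    span_one_sub_le_ker_counit (R := R) he he1 ha
  let gq : (B ⧸ I) →ₐ[R] k := Ideal.Quotient.liftₐ I g hgI
  let εq : (B ⧸ I) →ₐ[R] R := Ideal.Quotient.liftₐ I (Bialgebra.counitAlgHom R B) hεI
  have hgq : ∀ x, gq (Ideal.Quotient.mk I x) = g x := fun x => rfl
  have hεq : ∀ x, εq (Ideal.Quotient.mk I x) = Coalgebra.counit (R := R) x := fun x => rfl
  -- `gq` kills the maximal ideal of the corner: it is nilpotent modulo `𝔪_R B₀`, and `𝔪_R` dies in the reduced ring `k`
  have hkill : ∀ y ∈ maximalIdeal (B ⧸ I), gq y = 0 := by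
    intro y hy
    set J : Ideal (B ⧸ I) := (maximalIdeal R).map (algebraMap R (B ⧸ I)) with hJ
    have hJle : J ≤ maximalIdeal (B ⧸ I) :=
      Literature.RingTheory.Idempotents.map_maximalIdeal_le_of_isMaximal (R := R) _ inferInstance
    have hJtop : J ≠ ⊤ := fun h => (maximalIdeal.isMaximal (B ⧸ I)).ne_top (top_le_iff.mp (h ▸ hJle))
    haveI : Nontrivial ((B ⧸ I) ⧸ J) := Ideal.Quotient.nontrivial_iff.mpr hJtop
    haveI : IsArtinianRing ((B ⧸ I) ⧸ J) := Literature.RingTheory.Idempotents.isArtinianRing_quotient (R := R) (A := B ⧸ I)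
    haveI : IsLocalRing ((B ⧸ I) ⧸ J) := IsLocalRing.of_surjective' (Ideal.Quotient.mk J) Ideal.Quotient.mk_surjective
    obtain ⟨n, hn⟩ : IsNilpotent (maximalIdeal ((B ⧸ I) ⧸ J)) := by
      rw [← IsLocalRing.jacobson_eq_maximalIdeal ⊥ bot_ne_top]; exact IsArtinianRing.isNilpotent_jacobson_bot
    -- the image of `y` is a non-unit, hence nilpotent
    have hyJ : Ideal.Quotient.mk J y ∈ maximalIdeal ((B ⧸ I) ⧸ J) := by
      rw [IsLocalRing.mem_maximalIdeal, mem_nonunits_iff]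
      intro hu
      obtain ⟨z, hz⟩ := hu.exists_right_inv
      obtain ⟨z, rfl⟩ := Ideal.Quotient.mk_surjective z
      rw [← map_mul, ← map_one (Ideal.Quotient.mk J), Ideal.Quotient.eq] at hz
      have h1 : y * z ∈ maximalIdeal (B ⧸ I) := Ideal.mul_mem_right _ _ hy
      have : (1 : B ⧸ I) ∈ maximalIdeal (B ⧸ I) := by
        have h2 := (maximalIdeal (B ⧸ I)).sub_mem h1 (hJle hz); rwa [sub_sub_cancel] at h2
      exact (maximalIdeal.isMaximal (B ⧸ I)).ne_top ((Ideal.eq_top_iff_one _).2 this)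
    have hyn : y ^ n ∈ J := by
      rw [← Ideal.Quotient.eq_zero_iff_mem, map_pow]
      have := Ideal.pow_mem_pow hyJ n
      rw [hn, Ideal.zero_eq_bot, Ideal.mem_bot] at this
      exact this
    -- `gq (y ^ n) = 0` because `gq (J) ⊆ 𝔪_R k = 0`
    have hJk : J.map (gq : (B ⧸ I) →+* k) = ⊥ := by
      rw [hJ, Ideal.map_map, le_bot_iff.symm, Ideal.map_le_iff_le_comap]
      intro r hr
      rw [Ideal.mem_comap, RingHom.comp_apply, AlgHom.coe_toRingHom, AlgHom.commutes, Ideal.mem_bot]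
      exact hk hr
    have hgy : IsNilpotent (gq y) := ⟨n, by
      rw [← map_pow]
      have := Ideal.mem_map_of_mem (gq : (B ⧸ I) →+* k) hyn
      rwa [hJk, Ideal.mem_bot] at this⟩
    exact hgy.eq_zero
  -- `x ≡ εq x (mod 𝔪_{B₀})` (the kernel of `εq` is a proper ideal of the local corner)
  have hx : ∀ x : B ⧸ I, x - algebraMap R (B ⧸ I) (εq x) ∈ maximalIdeal (B ⧸ I) := fun x => by
    apply IsLocalRing.le_maximalIdeal (RingHom.ker_ne_top (εq : (B ⧸ I) →+* R))
    rw [RingHom.mem_ker, map_sub, AlgHom.coe_toRingHom, AlgHom.commutes, Algebra.algebraMap_self, RingHom.id_apply, sub_self]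
  have h := hkill _ (hx (Ideal.Quotient.mk I b))
  rw [map_sub, AlgHom.commutes, sub_eq_zero, hgq, hεq] at h
  exact h

end UnitCornerPoints

section BaseChange

variable {R : Type u} [CommRing R] [IsLocalRing R] {B : Type v} [CommRing B] [HopfAlgebra R B] [Module.Finite R B] [Module.Free R B]
  (k : Type w) [Field k] [IsAlgClosed k] [Algebra R k]

omit [IsLocalRing R] [Module.Finite R B] [Module.Free R B] [IsAlgClosed k] in
/-- The counit of the base change `k ⊗_R B` on an elementary tensor `1 ⊗ b` is `ε(b)·1`. [cite: Tate1997FiniteFlatGroupSchemes, (3.7)] -/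
theorem counit_one_tmul (b : B) :
    Coalgebra.counit (R := k) ((1 : k) ⊗ₜ[R] b) = algebraMap R k (Coalgebra.counit (R := R) b) := by
  rw [TensorProduct.counit_tmul, CommSemiring.counit_apply, Algebra.algebraMap_eq_smul_one]

omit [IsLocalRing R] [Module.Finite R B] [Module.Free R B] [IsAlgClosed k] in
/-- The counit point of `k ⊗_R B` is the base change of the counit point `b ↦ ε(b)·1` of `B` (Mathlib `AlgHom.liftEquiv`).
[cite: Tate1997FiniteFlatGroupSchemes, (3.7)] -/
theorem liftEquiv_ofId_comp_counitAlgHom :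
    AlgHom.liftEquiv R k B k ((Algebra.ofId R k).comp (Bialgebra.counitAlgHom R B)) = Bialgebra.counitAlgHom k (k ⊗[R] B) := by
  apply Algebra.TensorProduct.ext'
  intro s b
  rw [AlgHom.liftEquiv_tmul, Bialgebra.counitAlgHom_apply, TensorProduct.counit_tmul, CommSemiring.counit_apply, AlgHom.comp_apply,
    Algebra.ofId_apply, Bialgebra.counitAlgHom_apply, Algebra.smul_def, Algebra.smul_def, mul_comm, Algebra.algebraMap_self,
    RingHom.id_apply]

variable {k}

omit [Module.Free R B] in
/-- **`1 ⊗ e` is the unit separating idempotent of `k ⊗_R B`** when `e` is the one of `B` and `𝔪_R` dies in the algebraically closed field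
`k`: it is idempotent, `ε(1 ⊗ e) = 1`, and every OTHER maximal ideal of `k ⊗_R B` contains it — a maximal ideal is the kernel of a `k`-point
(Nullstellensatz), whose restriction `g : B → k` has `g(e) ∈ {0, 1}`, and `g(e) = 1` forces `g` to be the counit point
(`algHom_eq_of_map_unitIdempotent_eq_one`). [cite: Tate1997FiniteFlatGroupSchemes, (3.7) (pp. 140–142)] -/
theorem isUnitSeparating_one_tmul (hk : maximalIdeal R ≤ RingHom.ker (algebraMap R k)) {e : B} (he : IsIdempotentElem e)
    (he1 : e - 1 ∈ RingHom.ker ((residue R).comp (Bialgebra.counitAlgHom R B : B →+* R)))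
    (he0 : ∀ 𝔫 : Ideal B, 𝔫.IsMaximal → 𝔫 ≠ RingHom.ker ((residue R).comp (Bialgebra.counitAlgHom R B : B →+* R)) → e ∈ 𝔫) :
    IsIdempotentElem ((1 : k) ⊗ₜ[R] e) ∧
      (1 : k) ⊗ₜ[R] e - 1 ∈ RingHom.ker ((residue k).comp (Bialgebra.counitAlgHom k (k ⊗[R] B) : k ⊗[R] B →+* k)) ∧
      ∀ 𝔪 : Ideal (k ⊗[R] B), 𝔪.IsMaximal →
        𝔪 ≠ RingHom.ker ((residue k).comp (Bialgebra.counitAlgHom k (k ⊗[R] B) : k ⊗[R] B →+* k)) → (1 : k) ⊗ₜ[R] e ∈ 𝔪 := by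
  have hidem : IsIdempotentElem ((1 : k) ⊗ₜ[R] e) := by
    change (1 : k) ⊗ₜ[R] e * (1 : k) ⊗ₜ[R] e = (1 : k) ⊗ₜ[R] e
    rw [Algebra.TensorProduct.tmul_mul_tmul, one_mul, he.eq]
  -- `ε(1 ⊗ e) = 1`
  have hεe : Coalgebra.counit (R := k) ((1 : k) ⊗ₜ[R] e) = 1 := by
    rw [counit_one_tmul]
    have h1 : Coalgebra.counit (R := R) e - 1 ∈ maximalIdeal R := by
      rw [← IsLocalRing.residue_eq_zero_iff]
      have := he1
      rwa [RingHom.mem_ker, RingHom.comp_apply, AlgHom.coe_toRingHom, map_sub, map_one, Bialgebra.counitAlgHom_apply] at this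
    have h2 : algebraMap R k (Coalgebra.counit (R := R) e - 1) = 0 := hk h1
    rwa [map_sub, map_one, sub_eq_zero] at h2
  refine ⟨hidem, ?_, fun 𝔪 h𝔪 hne => ?_⟩
  · rw [RingHom.mem_ker, RingHom.comp_apply, AlgHom.coe_toRingHom, map_sub, map_one, Bialgebra.counitAlgHom_apply, hεe, sub_self,
      map_zero]
  · -- `𝔪` is the kernel of a `k`-point `g'`
    haveI := h𝔪
    letI : Field ((k ⊗[R] B) ⧸ 𝔪) := Ideal.Quotient.field 𝔪
    haveI : Algebra.IsIntegral k ((k ⊗[R] B) ⧸ 𝔪) := Algebra.IsIntegral.of_finite k _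
    let ek : ((k ⊗[R] B) ⧸ 𝔪) ≃ₐ[k] k :=
      (AlgEquiv.ofBijective (Algebra.ofId k ((k ⊗[R] B) ⧸ 𝔪))
        (IsAlgClosed.algebraMap_bijective_of_isIntegral (k := k) (K := (k ⊗[R] B) ⧸ 𝔪))).symm
    let g' : (k ⊗[R] B) →ₐ[k] k := (ek : ((k ⊗[R] B) ⧸ 𝔪) →ₐ[k] k).comp (Ideal.Quotient.mkₐ k 𝔪)
    have hker' : RingHom.ker (g' : (k ⊗[R] B) →+* k) = 𝔪 := by
      ext x
      rw [RingHom.mem_ker]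
      change ek (Ideal.Quotient.mk 𝔪 x) = 0 ↔ x ∈ 𝔪
      rw [map_eq_zero_iff _ ek.injective, Ideal.Quotient.eq_zero_iff_mem]
    -- `g' (1 ⊗ e)` is an idempotent of the field `k`
    rcases IsIdempotentElem.iff_eq_zero_or_one.mp (hidem.map g') with h0 | h1
    · rw [← hker', RingHom.mem_ker, AlgHom.coe_toRingHom]; exact h0
    · -- then the restriction `g` of `g'` to `B` passes through the unit corner, so `g'` is the counit point: contradiction
      exfalso
      let g : B →ₐ[R] k := (AlgHom.liftEquiv R k B k).symm g'
      have hge : g e = 1 := by rw [AlgHom.liftEquiv_symm_apply]; exact h1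
      have hgε : g = (Algebra.ofId R k).comp (Bialgebra.counitAlgHom R B) := by
        ext b
        rw [AlgHom.comp_apply, Algebra.ofId_apply, Bialgebra.counitAlgHom_apply]
        exact algHom_eq_of_map_unitIdempotent_eq_one (k := k) hk he he1 he0 g hge b
      have hg' : g' = Bialgebra.counitAlgHom k (k ⊗[R] B) := by
        rw [← liftEquiv_ofId_comp_counitAlgHom k, ← hgε]
        exact ((AlgHom.liftEquiv R k B k).apply_symm_apply g').symm
      apply hne
      -- kernels of `residue ∘ g'` and `g'` agree (`residue k` is injective)
      have hres : Function.Injective (residue k) := fun a b hab => by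
        have h0 : residue k (a - b) = 0 := by rw [map_sub, hab, sub_self]
        rw [IsLocalRing.residue_eq_zero_iff, IsLocalRing.mem_maximalIdeal, mem_nonunits_iff, isUnit_iff_ne_zero,
          not_not, sub_eq_zero] at h0
        exact h0
      rw [← hker', hg']
      ext x
      simp only [RingHom.mem_ker, RingHom.comp_apply]
      rw [← map_zero (residue k)]
      exact (hres.eq_iff).symm

/-- **TATE (3.7) over a local base, read at geometric points: `rank_R B = #(B →ₐ[R] k) · rank_R (B ⧸ (1 − e))`.**  `R` local, `B` a
module-finite FREE commutative Hopf `R`-algebra (a finite flat commutative group scheme `G = Spec B`) with unit separating idempotent `e`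
(`G⁰ = Spec (B ⧸ (1 − e))`), `k` an ALGEBRAICALLY CLOSED field with a structure map `R → k` killing `𝔪_R` (`k ⊇ κ(R)`); then
`rank_R B = #G(k) · rank_R Γ(G⁰)`.  Proof: §2 for the finite Hopf `k`-algebra `k ⊗_R B` (Mathlib) and its unit idempotent `1 ⊗ e`
(`isUnitSeparating_one_tmul`), with `dim_k (k ⊗ B) = rank_R B`, `(k ⊗ B →ₐ[k] k) ≃ (B →ₐ[R] k)` and `(k ⊗ B) ⧸ (1 − 1 ⊗ e) ≅ k ⊗_R (B ⧸ (1 − e))`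
of `k`-dimension `rank_R (B ⧸ (1 − e))` (a free corner, ★ `Idempotents.free_quotient_span_one_sub`).
[cite: Tate1997FiniteFlatGroupSchemes, (3.7) (pp. 140–142)] [cite: StacksProject, Tag 04GG] -/
theorem finrank_eq_card_algHom_mul_finrank_unitCorner_of_isLocalRing (hk : maximalIdeal R ≤ RingHom.ker (algebraMap R k)) {e : B}
    (he : IsIdempotentElem e) (he1 : e - 1 ∈ RingHom.ker ((residue R).comp (Bialgebra.counitAlgHom R B : B →+* R)))
    (he0 : ∀ 𝔫 : Ideal B, 𝔫.IsMaximal → 𝔫 ≠ RingHom.ker ((residue R).comp (Bialgebra.counitAlgHom R B : B →+* R)) → e ∈ 𝔫) :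
    Module.finrank R B = Nat.card (B →ₐ[R] k) * Module.finrank R (B ⧸ Ideal.span {1 - e}) := by
  obtain ⟨hidem, h1, h0⟩ := isUnitSeparating_one_tmul (k := k) hk he he1 he0
  have hC := finrank_eq_card_algHom_mul_finrank_unitCorner k (C := k ⊗[R] B) hidem h1 h0
  -- ranks and points commute with `k ⊗_R −`
  have hrk : Module.finrank k (k ⊗[R] B) = Module.finrank R B := Module.finrank_baseChange
  have hpt : Nat.card ((k ⊗[R] B) →ₐ[k] k) = Nat.card (B →ₐ[R] k) := Nat.card_congr (AlgHom.liftEquiv R k B k).symm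
  -- the corner: `(k ⊗ B) ⧸ (1 - 1 ⊗ e) ≃ₐ[k] k ⊗_R (B ⧸ (1 - e))`
  set I : Ideal B := Ideal.span {1 - e} with hI
  haveI : Module.Free R (B ⧸ I) := Literature.RingTheory.Idempotents.free_quotient_span_one_sub (R := R) he
  have hsurj : Function.Surjective (Algebra.TensorProduct.map (AlgHom.id k k) (Ideal.Quotient.mkₐ R I)) := by
    intro z
    induction z using TensorProduct.induction_on with
    | zero => exact ⟨0, map_zero _⟩
    | tmul s b =>
      obtain ⟨b', rfl⟩ := Ideal.Quotient.mk_surjective b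
      exact ⟨s ⊗ₜ b', by rw [Algebra.TensorProduct.map_tmul]; rfl⟩
    | add x y hx hy =>
      obtain ⟨x', rfl⟩ := hx
      obtain ⟨y', rfl⟩ := hy
      exact ⟨x' + y', map_add _ _ _⟩
  have hmk : RingHom.ker (Ideal.Quotient.mkₐ R I) = I := by
    ext x
    rw [RingHom.mem_ker, Ideal.Quotient.mkₐ_eq_mk, Ideal.Quotient.eq_zero_iff_mem]
  have hkerR : RingHom.ker (Algebra.TensorProduct.map (AlgHom.id R k) (Ideal.Quotient.mkₐ R I)) =
      Ideal.span {1 - (1 : k) ⊗ₜ[R] e} := by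
    rw [Algebra.TensorProduct.lTensor_ker _ Ideal.Quotient.mk_surjective, hmk, hI, Ideal.map_span, Set.image_singleton]
    congr 2
    rw [Algebra.TensorProduct.includeRight_apply, TensorProduct.tmul_sub, Algebra.TensorProduct.one_def]
  have hker : RingHom.ker (Algebra.TensorProduct.map (AlgHom.id k k) (Ideal.Quotient.mkₐ R I)) = Ideal.span {1 - (1 : k) ⊗ₜ[R] e} := by
    rw [← hkerR]; ext x; exact Iff.rfl
  have hcorner : Module.finrank k ((k ⊗[R] B) ⧸ Ideal.span {1 - (1 : k) ⊗ₜ[R] e}) = Module.finrank R (B ⧸ I) := by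
    rw [← Module.finrank_baseChange (R := k) (S := R) (M' := B ⧸ I)]
    exact ((Ideal.quotientEquivAlgOfEq k hker.symm).trans (Ideal.quotientKerAlgEquivOfSurjective hsurj)).toLinearEquiv.finrank_eq
  rw [← hrk, hC, hpt, hcorner]

end BaseChange

end Literature.RingTheory.Henselian

end
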